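import Mathlib
import Summits.PneNP.PneNP.Theorems.Nc03AvoidResidualCoreReductionLinB

/-!
# Route Nc03AvoidResidualCore, item `ResidualCoreReduction` — the `𝔽₂`-rank certificates, III: the `G`-class

Helper file for `stmt-PneNP-20227` (residual-core reduction of `NC⁰₃-AVOID` at linear stretch; cell
pnp-ideate, dossier HOME/pnp-ideate-p2/ROUND-3.md §2.6). Certificate SOUNDNESS and EXISTENCE for
PURE instances of the NPN class `10`, the `G`-class `(¬b ∧ ¬c) ∨ (a ∧ b ∧ c)` (head `a` = role `0`,
tails = roles `1,2`), in linear-algebra form: tail-rows `e_b + e_c ∈ 𝔽₂^N`; a greedy linearly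
independent spanning family `F = gset I i j` seeded with an output `i` and skipping a "non-bridge"
`j ≠ i` (tail-row spanned by the other tail-rows) of the same head; if some `g ∉ F` has
`e_{b_g} + e_{b_i}` in the span of the tail-rows other than `j`'s, the pattern `𝟙_F` is never
attained (`cert10_sound`). Such `(i, j, g)` exist once `M > 2N` (`cert10_exists`): the bridges are
linearly independent (`≤ N`), so two non-bridges share a head, and a coordinate projection onto the
tail class of `i` (`projK`) shows that the seeded family has the required `g`. All conditions are
span memberships of explicit vectors — decidable by a rank oracle. [folklore; ROUND-3 §2.6]
-/

set_option linter.dupNamespace false -- `Summit.PneNP.PneNP.…`: summit = sub-problem name (D-0017 single-conjunct layout)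

namespace Summit.PneNP.PneNP.Theorems.Nc03Reduction

open Finset Literature.Computability.Complexity

variable {N M : ℕ}

/-! ## Class 10: the `G`-class -/

/-- `G`-class bits that are `1` have equal tails. -/
theorem rep10_true_imp (a b c : Bool) (h : ((!b && !c) || (a && b && c)) = true) : b = c := by
  revert a b c h; decide

/-- `G`-class bits that are `0` with equal tails have tails `1` and head `0`. -/
theorem rep10_false_imp (a b c : Bool) (h : ((!b && !c) || (a && b && c)) = false) (hbc : b = c) :
    b = true ∧ a = false := by
  revert a b c h hbc; decide

/-- The outputs processed before `f` in the greedy order seeded with `i` and skipping `j`: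
`i` first (unless `f = i`), then the indices below `f` other than `i, j`. -/
def procSet (i j f : Fin M) : Finset (Fin M) :=
  Finset.univ.filter fun f' => f' ≠ j ∧ f' ≠ f ∧ (f' = i ∨ (f ≠ i ∧ f' < f))

/-- Membership in `procSet`. -/
theorem mem_procSet {i j f f' : Fin M} :
    f' ∈ procSet i j f ↔ f' ≠ j ∧ f' ≠ f ∧ (f' = i ∨ (f ≠ i ∧ f' < f)) := by
  simp [procSet]

open Classical in
/-- The greedy independent family of tail-rows seeded with `i`, skipping `j`: an output is kept iff
its tail-row is not in the span of the tail-rows processed before it. -/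
noncomputable def gset (I : LocalMap 3 N M) (i j : Fin M) : Finset (Fin M) :=
  Finset.univ.filter fun f =>
    f ≠ j ∧ row9 I f ∉ Submodule.span (ZMod 2) (row9 I '' ↑(procSet i j f))

/-- Membership in `gset`. -/
theorem mem_gset {I : LocalMap 3 N M} {i j f : Fin M} :
    f ∈ gset I i j ↔
      f ≠ j ∧ row9 I f ∉ Submodule.span (ZMod 2) (row9 I '' ↑(procSet i j f)) := by
  classical
  simp [gset]

/-- The processing weight: `i` first, then by index. -/
def pw (i f : Fin M) : ℕ := if f = i then 0 else f.val + 1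

/-- `procSet` is "smaller weight" (for `f' ≠ j`, `f' ≠ f`). -/
theorem mem_procSet_iff_pw {i j f' f : Fin M} (hj : f' ≠ j) (hf : f' ≠ f) :
    f' ∈ procSet i j f ↔ pw i f' < pw i f := by
  rw [mem_procSet]
  simp only [pw, Fin.ext_iff, Fin.lt_def, ne_eq] at *
  split_ifs <;> omega

/-- The weight is injective. -/
theorem pw_injective (i : Fin M) : Function.Injective (pw i) := by
  intro f f' h
  simp only [pw, Fin.ext_iff] at *
  split_ifs at h <;> omega

/-- A nonzero pair-row: the tails of a pure output are distinct variables. -/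
theorem row9_ne_zero {P : (Fin 3 → Bool) → Bool} {I : LocalMap 3 N M} (hP : I.IsPure P) (f : Fin M) :
    row9 I f ≠ 0 := by
  intro h
  have hne : I.vars f 1 ≠ I.vars f 2 := fun e => absurd (hP.2 f e) (by decide)
  have := congrFun h (I.vars f 1)
  simp only [row9, Pi.add_apply, ind, ↓reduceIte, Pi.zero_apply, if_neg hne] at this
  exact absurd this (by decide)

/-- The seed belongs to the greedy family (when it is not the skipped output). -/
theorem seed_mem_gset {P : (Fin 3 → Bool) → Bool} {I : LocalMap 3 N M} (hP : I.IsPure P)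
    {i j : Fin M} (hij : i ≠ j) : i ∈ gset I i j := by
  rw [mem_gset]
  refine ⟨hij, ?_⟩
  have hempty : (↑(procSet i j i) : Set (Fin M)) = ∅ := by
    ext f'
    simp only [Finset.mem_coe, mem_procSet, Set.mem_empty_iff_false, iff_false]
    rintro ⟨-, hfi, h | ⟨h, -⟩⟩
    · exact hfi h
    · exact h rfl
  rw [hempty, Set.image_empty, Submodule.span_empty, Submodule.mem_bot]
  exact row9_ne_zero hP i

/-- The skipped output is not in the greedy family. -/
theorem skip_notMem_gset (I : LocalMap 3 N M) (i j : Fin M) : j ∉ gset I i j := by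
  simp [mem_gset]

/-- The greedy family spans every row except possibly that of the skipped output. -/
theorem row9_mem_span_gset (I : LocalMap 3 N M) (i j : Fin M) :
    ∀ f, f ≠ j → row9 I f ∈ Submodule.span (ZMod 2) (row9 I '' ↑(gset I i j)) := by
  suffices h : ∀ n, ∀ f, pw i f = n → f ≠ j →
      row9 I f ∈ Submodule.span (ZMod 2) (row9 I '' ↑(gset I i j)) from
    fun f hf => h _ f rfl hf
  intro n
  induction n using Nat.strong_induction_on with
  | _ n ih =>
    intro f hfn hfj
    by_cases hf : f ∈ gset I i j
    · exact Submodule.subset_span ⟨f, hf, rfl⟩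
    · have hdep : row9 I f ∈ Submodule.span (ZMod 2) (row9 I '' ↑(procSet i j f)) := by
        by_contra hn
        exact hf (mem_gset.2 ⟨hfj, hn⟩)
      refine (Submodule.span_le.mpr ?_) hdep
      rintro v ⟨f', hf', rfl⟩
      have hf'' := mem_procSet.1 hf'
      have hlt : pw i f' < pw i f := (mem_procSet_iff_pw hf''.1 hf''.2.1).1 hf'
      exact ih (pw i f') (hfn ▸ hlt) f' rfl hf''.1

/-- The greedy family is linearly independent. -/
theorem gset_linearIndependent (I : LocalMap 3 N M) (i j : Fin M) :
    LinearIndependent (ZMod 2) (fun f : ↥(gset I i j) => row9 I (f : Fin M)) := by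
  refine linearIndependent_of_triangular (gset I i j) (row9 I) (pw i)
    (fun f _ f' _ h => pw_injective i h) ?_
  intro f hf hmem
  apply (mem_gset.1 hf).2
  refine Submodule.span_mono ?_ hmem
  rintro v ⟨f', ⟨hf'S, hlt⟩, rfl⟩
  have hf'j : f' ≠ j := (mem_gset.1 hf'S).1
  have hf'f : f' ≠ f := fun e => by subst e; exact lt_irrefl _ hlt
  exact ⟨f', (mem_procSet_iff_pw hf'j hf'f).2 hlt, rfl⟩

/-- Soundness, class `10` (`G`-class, head = role `0`, tails = roles `1,2`). Pattern `𝟙_F` for the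
greedy family `F = gset I i j` (`i ≠ j` of the same head, `j` a non-bridge: its tail-row is spanned
by the other tail-rows), provided some `g ∉ F` has `e_{b_g} + e_{b_i}` in the span of the tail-rows
other than `j`'s. Never attained: every output then has equal tails; the `0`-outputs `j` and `g`
have tails `1` and heads `0`; `g`'s tail is connected to `i`'s, so `i` has tails `1` and — its bit
being `1` — head `1`; but `i` and `j` share their head. [ROUND-3 §2.6, linear-algebra form] -/
theorem cert10_sound {I : LocalMap 3 N M} (hP : I.IsPure (rep 10)) {i j g : Fin M} (hij : i ≠ j)
    (hhead : I.vars i 0 = I.vars j 0)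
    (hj : row9 I j ∈ Submodule.span (ZMod 2) (row9 I '' {f | f ≠ j}))
    (hg : g ∉ gset I i j)
    (hconn : ind (I.vars g 1) + ind (I.vars i 1) ∈ Submodule.span (ZMod 2) (row9 I '' {f | f ≠ j}))
    {y : Fin M → Bool} (hy : ∀ f, y f = true ↔ f ∈ gset I i j) : y ∉ I.range := by
  rintro ⟨x, hx⟩
  -- rows of `F` are orthogonal to `x`
  have horthF : ∀ s ∈ row9 I '' ↑(gset I i j), chi x ⬝ᵥ s = 0 := by
    rintro s ⟨f, hf, rfl⟩
    have h := (hy f).2 hf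
    rw [← hx, eval_of_isPure hP] at h
    simp only [rep] at h
    rw [row9, chi_dot_pair, bit_eq_zero, xor_eq_false_iff']
    exact rep10_true_imp _ _ _ h
  -- hence every row other than `j`'s, and `j`'s too
  have horth_ne : ∀ s ∈ row9 I '' {f | f ≠ j}, chi x ⬝ᵥ s = 0 := by
    rintro s ⟨f, hf, rfl⟩
    exact dot_eq_zero_of_mem_span (chi x) horthF (row9_mem_span_gset I i j f hf)
  have htails : ∀ f, x (I.vars f 1) = x (I.vars f 2) := by
    intro f
    have h0 : chi x ⬝ᵥ row9 I f = 0 := by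
      by_cases hf : f = j
      · rw [hf]; exact dot_eq_zero_of_mem_span (chi x) horth_ne hj
      · exact horth_ne _ ⟨f, hf, rfl⟩
    rwa [row9, chi_dot_pair, bit_eq_zero, xor_eq_false_iff'] at h0
  -- the `0`-outputs have tails `1` and head `0`
  have hzero : ∀ f, f ∉ gset I i j → x (I.vars f 1) = true ∧ x (I.vars f 0) = false := by
    intro f hf
    have h : y f = false := by
      cases h : y f
      · rfl
      · exact absurd ((hy f).1 h) hf
    rw [← hx, eval_of_isPure hP] at h
    simp only [rep] at h
    exact rep10_false_imp _ _ _ h (htails f)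
  have hj0 := (hzero j (skip_notMem_gset I i j)).2
  rw [← hhead] at hj0
  -- `i` has tails `1`, hence head `1`: contradiction
  have hconn0 := dot_eq_zero_of_mem_span (chi x) horth_ne hconn
  rw [chi_dot_pair, bit_eq_zero, xor_eq_false_iff'] at hconn0
  have hi1 : x (I.vars i 1) = true := by rw [← hconn0]; exact (hzero g hg).1
  have hi2 : x (I.vars i 2) = true := by rw [← htails i]; exact hi1
  have hyi := (hy i).2 (seed_mem_gset hP hij)
  rw [← hx, eval_of_isPure hP] at hyi
  simp [rep, hi1, hi2, hj0] at hyi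

open Classical in
/-- The bridges: outputs whose tail-row is NOT spanned by the other tail-rows. -/
noncomputable def bridges (I : LocalMap 3 N M) : Finset (Fin M) :=
  Finset.univ.filter fun f => row9 I f ∉ Submodule.span (ZMod 2) (row9 I '' {f' | f' ≠ f})

/-- Membership in `bridges`. -/
theorem mem_bridges {I : LocalMap 3 N M} {f : Fin M} :
    f ∈ bridges I ↔ row9 I f ∉ Submodule.span (ZMod 2) (row9 I '' {f' | f' ≠ f}) := by
  classical
  simp [bridges]

/-- At most `N` bridges (they are linearly independent). -/
theorem card_bridges_le (I : LocalMap 3 N M) : (bridges I).card ≤ N := by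
  refine card_le_of_triangular _ (row9 I) fun e he hmem => ?_
  apply mem_bridges.1 he
  refine Submodule.span_mono ?_ hmem
  rintro v ⟨f, ⟨-, hfe⟩, rfl⟩
  exact ⟨f, ne_of_lt hfe, rfl⟩

/-- The coordinate projection onto a set of variables. -/
noncomputable def projK (K : Finset (Fin N)) : Vec N →ₗ[ZMod 2] Vec N where
  toFun w := fun u => if u ∈ K then w u else 0
  map_add' w w' := by
    ext u; simp only [Pi.add_apply]; split <;> simp
  map_smul' c w := by
    ext u; simp only [Pi.smul_apply, smul_eq_mul, RingHom.id_apply]; split <;> simp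

/-- Unfolding `projK`. -/
theorem projK_apply (K : Finset (Fin N)) (w : Vec N) (u : Fin N) :
    projK K w u = if u ∈ K then w u else 0 := rfl

/-- Projection of a pair-row supported in `K`. -/
theorem projK_pair_of_mem {K : Finset (Fin N)} {u w : Fin N} (hu : u ∈ K) (hw : w ∈ K) :
    projK K (ind u + ind w) = ind u + ind w := by
  ext v
  rw [projK_apply]
  split
  · rfl
  · have hvu : v ≠ u := by rintro rfl; exact ‹v ∉ K› hu
    have hvw : v ≠ w := by rintro rfl; exact ‹v ∉ K› hw
    simp [ind, hvu, hvw]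

/-- Projection of a pair-row disjoint from `K`. -/
theorem projK_pair_of_notMem {K : Finset (Fin N)} {u w : Fin N} (hu : u ∉ K) (hw : w ∉ K) :
    projK K (ind u + ind w) = 0 := by
  ext v
  rw [projK_apply]
  split
  · have hvu : v ≠ u := by rintro rfl; exact hu ‹v ∈ K›
    have hvw : v ≠ w := by rintro rfl; exact hw ‹v ∈ K›
    simp [ind, hvu, hvw]
  · rfl

/-- Existence, class `10`: with `M > 2N` the pattern of `cert10_sound` exists. Two non-bridges
`i ≠ j` share a head (bridges are independent, heads are `≤ N`); for them some `g ∉ gset I i j` is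
tail-connected to `i`: otherwise the tail-class `K` of `i` meets only members of the independent
family, and projecting a dependency of the non-bridge `i` onto `K` contradicts independence. -/
theorem cert10_exists {I : LocalMap 3 N M} (hP : I.IsPure (rep 10)) (hM : 2 * N < M) :
    ∃ i j g : Fin M, i ≠ j ∧ I.vars i 0 = I.vars j 0 ∧
      row9 I j ∈ Submodule.span (ZMod 2) (row9 I '' {f | f ≠ j}) ∧ g ∉ gset I i j ∧
      ind (I.vars g 1) + ind (I.vars i 1) ∈ Submodule.span (ZMod 2) (row9 I '' {f | f ≠ j}) := by
  classical
  -- two non-bridges with a common head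
  have hNBcard : N < ((Finset.univ : Finset (Fin M)).filter fun f => f ∉ bridges I).card := by
    have hsplit := Finset.card_filter_add_card_filter_not (s := (Finset.univ : Finset (Fin M)))
      (fun f => f ∈ bridges I)
    have hfe : (Finset.univ : Finset (Fin M)).filter (fun f => f ∈ bridges I) = bridges I := by
      ext; simp
    rw [hfe] at hsplit
    have hb := card_bridges_le I
    simp only [Finset.card_univ, Fintype.card_fin] at hsplit
    omega
  obtain ⟨i, hi, j, hj, hij, hhead⟩ := Finset.exists_ne_map_eq_of_card_lt_of_maps_to
    (t := (Finset.univ : Finset (Fin N))) (f := fun f => I.vars f 0) (by simpa using hNBcard)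
    (fun _ _ => Finset.mem_univ _)
  have hnb : ∀ f ∈ ((Finset.univ : Finset (Fin M)).filter fun f => f ∉ bridges I),
      row9 I f ∈ Submodule.span (ZMod 2) (row9 I '' {f' | f' ≠ f}) := by
    intro f hf
    have := (Finset.mem_filter.1 hf).2
    rwa [mem_bridges, not_not] at this
  refine ⟨i, j, ?_⟩
  by_contra hno
  push Not at hno
  have hno' : ∀ g, g ∉ gset I i j → ind (I.vars g 1) + ind (I.vars i 1) ∉
      Submodule.span (ZMod 2) (row9 I '' {f | f ≠ j}) :=
    fun g hg => hno g hij hhead (hnb j hj) hg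
  -- the tail class of `i`
  set W := Submodule.span (ZMod 2) (row9 I '' {f | f ≠ j}) with hW
  set K : Finset (Fin N) := Finset.univ.filter fun u => ind u + ind (I.vars i 1) ∈ W with hK
  have hmemK : ∀ u, u ∈ K ↔ ind u + ind (I.vars i 1) ∈ W := by
    intro u; simp [hK]
  have hKi : I.vars i 1 ∈ K := by
    rw [hmemK]
    have : ind (I.vars i 1) + ind (I.vars i 1) = (0 : Vec N) := by
      ext u; simp only [Pi.add_apply, ind, Pi.zero_apply]; split <;> decide
    rw [this]; exact Submodule.zero_mem _
  have hrowW : ∀ f, row9 I f ∈ W := by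
    intro f
    by_cases hf : f = j
    · rw [hf]; exact hnb j hj
    · exact Submodule.subset_span ⟨f, hf, rfl⟩
  -- tails never straddle `K`
  have vecid : ∀ a b c : Fin N, ind a + ind b + (ind a + ind c) = (ind b + ind c : Vec N) := by
    intro a b c; ext u; simp only [Pi.add_apply, ind]; split_ifs <;> decide
  have hK12 : ∀ f, I.vars f 1 ∈ K ↔ I.vars f 2 ∈ K := by
    intro f
    rw [hmemK, hmemK]
    have hr := hrowW f
    rw [row9] at hr
    constructor
    · intro h
      have := Submodule.add_mem _ hr h
      rwa [vecid] at this
    · intro h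
      have hr' : ind (I.vars f 2) + ind (I.vars f 1) ∈ W := by rwa [add_comm] at hr
      have := Submodule.add_mem _ hr' h
      rwa [vecid] at this
  -- outputs with tails in `K` belong to the greedy family
  have hinF : ∀ f, I.vars f 1 ∈ K → f ∈ gset I i j := by
    intro f hf
    by_contra hfF
    exact hno' f hfF ((hmemK _).1 hf)
  -- project a dependency of the non-bridge `i` onto `K`
  have hproj : projK K (row9 I i) ∈ Submodule.span (ZMod 2)
      (projK K '' (row9 I '' {f' | f' ≠ i})) := by
    rw [← Submodule.map_span]
    exact Submodule.mem_map_of_mem (hnb i hi)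
  rw [row9, projK_pair_of_mem hKi ((hK12 i).1 hKi)] at hproj
  have hle : Submodule.span (ZMod 2) (projK K '' (row9 I '' {f' | f' ≠ i})) ≤
      Submodule.span (ZMod 2)
        ((fun f : ↥(gset I i j) => row9 I (f : Fin M)) '' {f | (f : Fin M) ≠ i}) := by
    rw [Submodule.span_le]
    rintro v ⟨w, ⟨f', hf'i, rfl⟩, rfl⟩
    by_cases h1 : I.vars f' 1 ∈ K
    · have h2 := (hK12 f').1 h1
      rw [row9, projK_pair_of_mem h1 h2]
      exact Submodule.subset_span ⟨⟨f', hinF f' h1⟩, hf'i, rfl⟩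
    · have h2 : I.vars f' 2 ∉ K := fun h => h1 ((hK12 f').2 h)
      rw [row9, projK_pair_of_notMem h1 h2]
      exact Submodule.zero_mem _
  have hind := (gset_linearIndependent I i j).notMem_span_image
    (s := {f : ↥(gset I i j) | (f : Fin M) ≠ i}) (x := ⟨i, seed_mem_gset hP hij⟩)
    (by simp)
  exact hind (hle hproj)

end Summit.PneNP.PneNP.Theorems.Nc03Reduction
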